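import Summits.Ventures.CertifiedQuantumChemistry.Rows.KernelFacialReduction
import Summits.Ventures.CertifiedQuantumChemistry.Rows.ExactLDLDecision
import Literature.Computation.Certificates.PosSemidefInt
import HarnessLib

/-!
# Ventures/CertifiedQuantumChemistry — Rows/ResidualScreenPSD.lean: soundness of the residual screen
# (exact structural kernel + integer Gram/Gershgorin residual ⇒ block PSD; δ-shift ⇒ exact kernel and rank)

HONEST FRAMING (verbatim): certified bounds for a stated model Hamiltonian in a stated basis; not a
claim about the real molecule beyond that model.

Seat rdm-B (gen 34), zero compute; a courtesy file of the X∞ structure ladder (no row, no claim node,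
nothing asserted about any model, nothing of record moves). It types the composition behind the
symmetry-free exact PSD verification measured in gen 31 (`pub-qchem-rdmb/tools/resid-g31/README.md`,
«RESIDUAL SCREEN (measured)»): for one block `M` of an exact rational certificate point,

1. the structural kernel vectors of record `W` are verified EXACTLY (`M * W = 0`) and a set `T` of
   `|T| = rank W` indices is DROPPED so that the `T`-rows of `W` are invertible — by
   `Rows/KernelFacialReduction.lean` the block is PSD iff its KEPT principal submatrix `M[S,S]` is;
2. a floating-point Cholesky factor of `M[S,S]` (or of `M[S,S] − δ·1`) is rounded to integers at scale
   `2^s`; the EXACT integer residual `A − Fᵀ·diag d·F` with `A = c • M[S,S]` (resp. `c • (M[S,S] − δ·1)`)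
   is tested for symmetric diagonal dominance (Gershgorin) — `PSD.IsGramCertZ A d F` of
   `Literature/Computation/Certificates/PosSemidefInt.lean`, a decidable integer predicate.

Float PROPOSES, integers DECIDE. The theorems:

* `ResidualScreen.posSemidef_kept_of_certZ` — the integer certificate with the positive scaling `c`
  makes the kept block PSD over any linearly ordered field;
* `ResidualScreen.posSemidef_of_kernel_certZ` — composed with the facial reduction: the whole block is PSD;
* `ResidualScreen.posSemidef_rat_and_real_of_kernel_certZ` — rational data, conclusion over `ℚ` AND for the
  real matrix `M.map Rat.cast` (what `Rows/ExactEnclosureCertificate.lean` consumes);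
* `ResidualScreen.posDef_of_posSemidef_sub_smul_one` — a PSD certificate for `N − δ·1` with `0 < δ` makes
  `N` positive DEFINITE;
* `ResidualScreen.mulVec_eq_zero_iff_of_posDef_kept`, `.ker_mulVecLin_eq_range`,
  `.finrank_ker_eq_card_dropped`, `.rank_eq_card_kept` — when the kept block is positive definite the
  block's kernel IS the structural span `range W`, its nullity is `|T|` and its rank is `|S|` (the
  'max-rank' / rank words printed by the checkers of record, here obtained WITHOUT elimination);
* `ResidualScreen.kernel_exact_of_certZ_shift` — all of it from one δ-shifted integer certificate.

Everything is PROVED (0 sorry); [folklore] throughout (Gershgorin; facial reduction of a spectrahedron by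
a known kernel, Borwein–Wolkowicz 1981 / Permenter–Parrilo 2018 §2; rank–nullity).
-/

namespace Summit.Ventures.CertifiedQuantumChemistry

namespace ResidualScreen

open Matrix Module Literature.Computation.Certificates

/-! ### §1 The integer certificate decides the kept block (any linearly ordered field) -/

section Kept

variable {R : Type*} [Field R] [LinearOrder R] [IsStrictOrderedRing R]
variable {k r : ℕ} {A : Matrix (Fin k) (Fin k) ℤ} {d : Fin r → ℕ} {F : Matrix (Fin r) (Fin k) ℤ}

omit [LinearOrder R] [IsStrictOrderedRing R] in
/-- Scaling side condition `A = c • N` read as a matrix identity. [folklore] -/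
theorem map_intCast_eq_smul {c : R} {N : Matrix (Fin k) (Fin k) R}
    (hA : ∀ i j, ((A i j : ℤ) : R) = c * N i j) : A.map (Int.cast : ℤ → R) = c • N := by
  ext i j
  rw [map_apply, hA, Matrix.smul_apply, smul_eq_mul]

/-- **Quadratic form of the kept block.** If `IsGramCertZ A d F` and `A = c • N` entrywise with `0 < c`,
then `xᵀ N x ≥ 0` for every `x`. [folklore] -/
theorem dotProduct_mulVec_nonneg_of_certZ (hcert : PSD.IsGramCertZ A d F) {c : R} (hc : 0 < c)
    {N : Matrix (Fin k) (Fin k) R} (hA : ∀ i j, ((A i j : ℤ) : R) = c * N i j) (x : Fin k → R) :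
    0 ≤ x ⬝ᵥ (N *ᵥ x) := by
  have h1 := hcert.dotProduct_mulVec_nonneg (R := R) x
  rw [map_intCast_eq_smul hA, smul_mulVec, dotProduct_smul, smul_eq_mul] at h1
  exact (mul_nonneg_iff_of_pos_left hc).mp h1

omit [IsStrictOrderedRing R] in
/-- The scaled matrix `N` is symmetric (the certificate makes `A` symmetric and `c ≠ 0`). [folklore] -/
theorem isSymm_of_certZ (hcert : PSD.IsGramCertZ A d F) {c : R} (hc : 0 < c)
    {N : Matrix (Fin k) (Fin k) R} (hA : ∀ i j, ((A i j : ℤ) : R) = c * N i j) : N.IsSymm :=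
  Matrix.IsSymm.ext fun i j => by
    have h1 : A j i = A i j := hcert.isSymm.apply i j
    have h2 : c * N j i = c * N i j := by rw [← hA, ← hA, h1]
    exact mul_left_cancel₀ hc.ne' h2

variable [StarRing R] [TrivialStar R]

/-- **The kept block is PSD** from the integer certificate and the positive scaling. [folklore] -/
theorem posSemidef_kept_of_certZ (hcert : PSD.IsGramCertZ A d F) {c : R} (hc : 0 < c)
    {N : Matrix (Fin k) (Fin k) R} (hA : ∀ i j, ((A i j : ℤ) : R) = c * N i j) : N.PosSemidef :=
  PosSemidef.of_dotProduct_mulVec_nonneg (isHermitian_iff_isSymm.mpr (isSymm_of_certZ hcert hc hA))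
    fun x => by simpa only [star_trivial] using dotProduct_mulVec_nonneg_of_certZ hcert hc hA x

end Kept

/-! ### §2 Composition with the index-dropping facial reduction: the whole block is PSD -/

section Compose

variable {R : Type*} [Field R] [LinearOrder R] [IsStrictOrderedRing R] [StarRing R] [TrivialStar R]
variable {T m : Type*} [Fintype T] [DecidableEq T] [Fintype m] {k r : ℕ}

/-- **RESIDUAL SCREEN, ONE BLOCK.** Let `M` be Hermitian, `W` a matrix of EXACT kernel vectors
(`M * W = 0`), `e : Fin k ⊕ T ≃ m` a splitting of the indices into `k` kept and `|T|` dropped ones with the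
dropped rows of `W` invertible, and let the integer certificate `IsGramCertZ A d F` hold for
`A = c • M[S,S]` (`0 < c`, `S` = the kept indices in the order `e ∘ inl`). Then `M` is positive
semidefinite. [folklore] -/
theorem posSemidef_of_kernel_certZ {M : Matrix m m R} (hM : M.IsHermitian) {W : Matrix m T R}
    (hMW : M * W = 0) (e : Fin k ⊕ T ≃ m) [Invertible (W.submatrix e id).toRows₂]
    {A : Matrix (Fin k) (Fin k) ℤ} {d : Fin r → ℕ} {F : Matrix (Fin r) (Fin k) ℤ}
    (hcert : PSD.IsGramCertZ A d F) {c : R} (hc : 0 < c)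
    (hA : ∀ i j, ((A i j : ℤ) : R) = c * M (e (Sum.inl i)) (e (Sum.inl j))) : M.PosSemidef :=
  (posSemidef_iff_submatrix_of_mul_eq_zero hM hMW e).mpr
    (posSemidef_kept_of_certZ hcert hc (N := M.submatrix (e ∘ Sum.inl) (e ∘ Sum.inl))
      fun i j => by rw [submatrix_apply, Function.comp_apply, Function.comp_apply, hA])

end Compose

/-! ### §3 Rational data: the conclusion over `ℚ` and for the real matrix `M.map Rat.cast` -/

section Rational

variable {T m : Type*} [Fintype T] [DecidableEq T] [Fintype m] {k r : ℕ}

/-- A PSD rational matrix (any finite index type) casts to a PSD real matrix — via the exact `LDLᵀ`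
decision of `Rows/ExactLDLDecision.lean` after reindexing to `Fin (card m)`. [folklore] -/
theorem posSemidef_map_ratCast {M : Matrix m m ℚ} (h : M.PosSemidef) :
    (M.map (Rat.cast : ℚ → ℝ)).PosSemidef := by
  classical
  set e := (Fintype.equivFin m).symm with he
  have hsymm : M.IsSymm := isHermitian_iff_isSymm.mp h.isHermitian
  have h1 : (M.submatrix e e).PosSemidef := (posSemidef_submatrix_equiv e).mpr h
  have h2 : ((M.submatrix e e).map (Rat.cast : ℚ → ℝ)).PosSemidef :=
    (ExactLDL.posSemidef_rat_iff_real _ (hsymm.submatrix e)).mp h1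
  rw [← submatrix_map] at h2
  exact (posSemidef_submatrix_equiv e).mp h2

/-- **RESIDUAL SCREEN, RATIONAL DATA.** For a symmetric rational block `M`, exact rational kernel vectors
`W` (`M * W = 0`) with invertible dropped rows, and an integer certificate `IsGramCertZ A d F` for
`A = c • M[S,S]` with a positive RATIONAL `c` (in the tool: `c = den · 2^{2s}`), the block is PSD over `ℚ`
and the REAL matrix `M.map Rat.cast` is PSD — the hypothesis shape consumed block by block by
`Rows/ExactEnclosureCertificate.lean`. [folklore] -/
theorem posSemidef_rat_and_real_of_kernel_certZ {M : Matrix m m ℚ} (hM : M.IsSymm) {W : Matrix m T ℚ}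
    (hMW : M * W = 0) (e : Fin k ⊕ T ≃ m) [Invertible (W.submatrix e id).toRows₂]
    {A : Matrix (Fin k) (Fin k) ℤ} {d : Fin r → ℕ} {F : Matrix (Fin r) (Fin k) ℤ}
    (hcert : PSD.IsGramCertZ A d F) {c : ℚ} (hc : 0 < c)
    (hA : ∀ i j, (A i j : ℚ) = c * M (e (Sum.inl i)) (e (Sum.inl j))) :
    M.PosSemidef ∧ (M.map (Rat.cast : ℚ → ℝ)).PosSemidef := by
  have h1 : M.PosSemidef :=
    posSemidef_of_kernel_certZ (isHermitian_iff_isSymm.mpr hM) hMW e hcert hc hA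
  exact ⟨h1, posSemidef_map_ratCast h1⟩

end Rational

/-! ### §4 δ-shift: a certificate for `N − δ·1` with `δ > 0` makes the kept block positive DEFINITE,
and then the structural span is the WHOLE kernel -/

section Shift

variable {R : Type*} [Field R] [LinearOrder R] [IsStrictOrderedRing R] [StarRing R] [TrivialStar R]

omit [StarRing R] [TrivialStar R] in
/-- `x ⬝ᵥ x > 0` for `x ≠ 0` over a linearly ordered field (sum of squares). [folklore] -/
theorem dotProduct_self_pos_of_ne_zero {n : Type*} [Fintype n] {x : n → R} (hx : x ≠ 0) :
    0 < x ⬝ᵥ x := by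
  have h0 : 0 ≤ x ⬝ᵥ x := Finset.sum_nonneg fun i _ => mul_self_nonneg (x i)
  rcases h0.lt_or_eq with h | h
  · exact h
  · exact absurd (dotProduct_self_eq_zero.mp h.symm) hx

/-- **δ-SHIFT.** If `N` is Hermitian, `0 < δ` and `N − δ·1` is positive semidefinite, then `N` is positive
definite: `xᵀ N x = xᵀ (N − δ·1) x + δ‖x‖² > 0` for `x ≠ 0`. [folklore] -/
theorem posDef_of_posSemidef_sub_smul_one {n : Type*} [Fintype n] [DecidableEq n] {N : Matrix n n R}
    (hN : N.IsHermitian) {δ : R} (hδ : 0 < δ) (h : (N - δ • (1 : Matrix n n R)).PosSemidef) :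
    N.PosDef := by
  refine PosDef.of_dotProduct_mulVec_pos hN fun x hx => ?_
  have h1 : 0 ≤ star x ⬝ᵥ ((N - δ • (1 : Matrix n n R)) *ᵥ x) := h.dotProduct_mulVec_nonneg x
  have h2 : star x ⬝ᵥ (N *ᵥ x) = star x ⬝ᵥ ((N - δ • (1 : Matrix n n R)) *ᵥ x) + δ * (x ⬝ᵥ x) := by
    rw [sub_mulVec, smul_mulVec, one_mulVec, dotProduct_sub, dotProduct_smul, smul_eq_mul,
      star_trivial, sub_add_cancel]
  rw [h2]
  exact add_pos_of_nonneg_of_pos h1 (mul_pos hδ (dotProduct_self_pos_of_ne_zero hx))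

/-- With TRIVIAL star the certificate of §1 for the shifted matrix reads: `IsGramCertZ A d F`,
`A = c • (N − δ·1)`, `0 < c`, `0 < δ` ⇒ `N` positive definite. [folklore] -/
theorem posDef_kept_of_certZ_shift {k r : ℕ} {A : Matrix (Fin k) (Fin k) ℤ} {d : Fin r → ℕ}
    {F : Matrix (Fin r) (Fin k) ℤ} (hcert : PSD.IsGramCertZ A d F) {c δ : R} (hc : 0 < c) (hδ : 0 < δ)
    {N : Matrix (Fin k) (Fin k) R} (hN : N.IsSymm)
    (hA : ∀ i j, ((A i j : ℤ) : R) = c * (N - δ • (1 : Matrix (Fin k) (Fin k) R)) i j) : N.PosDef :=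
  posDef_of_posSemidef_sub_smul_one (isHermitian_iff_isSymm.mpr hN) hδ
    (posSemidef_kept_of_certZ hcert hc hA)

end Shift

/-! ### §5 Kernel exactness and rank from a positive definite kept block -/

section Kernel

variable {R : Type*} [Field R]

/-- `W` has full column rank: invertible dropped rows make `t ↦ W t` injective. [folklore] -/
theorem mulVecLin_injective_of_invertible_rows {S T m : Type*} [Fintype T] [DecidableEq T] [Fintype m]
    (W : Matrix m T R) (e : S ⊕ T ≃ m) [Invertible (W.submatrix e id).toRows₂] :
    Function.Injective W.mulVecLin := by
  rw [← LinearMap.ker_eq_bot, LinearMap.ker_eq_bot']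
  intro t ht
  have h0 : W *ᵥ t = 0 := ht
  have h1 : (W.submatrix e id).toRows₂ *ᵥ t = 0 := by
    funext i
    have := congrFun h0 (e (Sum.inr i))
    simpa only [toRows₂, submatrix_apply, mulVec, of_apply, id_eq, Pi.zero_apply] using this
  have h2 := congrArg (fun v => ⅟((W.submatrix e id).toRows₂) *ᵥ v) h1
  simpa only [mulVec_mulVec, invOf_mul_self, one_mulVec, mulVec_zero] using h2

variable [PartialOrder R] [StarRing R]

/-- Block form. `B` on `S ⊕ T` with `B * W = 0`, the `T`-rows of `W` invertible, and the kept block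
`B.toBlocks₁₁` positive definite ⇒ every kernel vector of `B` lies in the column span of `W`.
(Decompose `x = s + W t` with `s` supported on `S`; `B s = 0`, so `s_Sᵀ B₁₁ s_S = sᵀ B s = 0` forces
`s = 0`.) [folklore] -/
theorem exists_eq_mulVec_of_mulVec_eq_zero_blocks {S T : Type*} [Fintype S] [Fintype T] [DecidableEq T]
    {B : Matrix (S ⊕ T) (S ⊕ T) R} {W : Matrix (S ⊕ T) T R} (hBW : B * W = 0)
    [Invertible W.toRows₂] (hpos : B.toBlocks₁₁.PosDef) {x : S ⊕ T → R} (hx : B *ᵥ x = 0) :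
    ∃ t : T → R, x = W *ᵥ t := by
  set t : T → R := ⅟(W.toRows₂) *ᵥ (fun i => x (Sum.inr i)) with ht
  set u : S ⊕ T → R := W *ᵥ t with hu_def
  have hu : B *ᵥ u = 0 := by rw [hu_def, mulVec_mulVec, hBW, zero_mulVec]
  have hT : ∀ i : T, u (Sum.inr i) = x (Sum.inr i) := by
    intro i
    have h1 : u (Sum.inr i) = (W.toRows₂ *ᵥ t) i := rfl
    rw [h1, ht, mulVec_mulVec, mul_invOf_self, one_mulVec]
  set s : S ⊕ T → R := x - u with hs_def
  have hs : s = Sum.elim (fun j => s (Sum.inl j)) 0 := by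
    funext i
    cases i with
    | inl j => rfl
    | inr i => simp [hs_def, hT i]
  have hBs : B *ᵥ s = 0 := by rw [hs_def, mulVec_sub, hx, hu, sub_zero]
  -- the quadratic form of the kept block vanishes at the `S`-part of `s`
  have hq : star (fun j => s (Sum.inl j)) ⬝ᵥ (B.toBlocks₁₁ *ᵥ fun j => s (Sum.inl j)) = 0 := by
    rw [← star_sumElim_zero_dotProduct_mulVec B, ← hs, hBs, dotProduct_zero]
  have hS : (fun j => s (Sum.inl j)) = 0 := by
    by_contra hne
    exact (hpos.dotProduct_mulVec_pos hne).ne' hq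
  refine ⟨t, ?_⟩
  have hs0 : s = 0 := by
    rw [hs, hS]
    funext i
    cases i <;> rfl
  have : x - u = 0 := hs0
  rw [sub_eq_zero] at this
  rw [this]

/-- **KERNEL EXACTNESS (general index type).** `B * W = 0`, `e : S ⊕ T ≃ m` with the dropped rows of `W`
invertible, and the kept principal submatrix `B[S,S]` positive DEFINITE ⇒ `B x = 0 ↔ x ∈ range W`: the
structural span is the whole kernel ('anchor MAX-RANK' / 'every kernel vector is structural'; no symmetry of
`B` is needed for this direction of use). [folklore] -/
theorem mulVec_eq_zero_iff_of_posDef_kept {S T m : Type*} [Fintype S] [Fintype T] [DecidableEq T]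
    [Fintype m] {B : Matrix m m R} {W : Matrix m T R} (hBW : B * W = 0)
    (e : S ⊕ T ≃ m) [Invertible (W.submatrix e id).toRows₂]
    (hpos : (B.submatrix (e ∘ Sum.inl) (e ∘ Sum.inl)).PosDef) (x : m → R) :
    B *ᵥ x = 0 ↔ ∃ t : T → R, x = W *ᵥ t := by
  constructor
  · intro hx
    have hBW' : B.submatrix e e * W.submatrix e id = 0 := by
      rw [← submatrix_mul B W e e id e.bijective, hBW, submatrix_zero, Pi.zero_apply, Pi.zero_apply]
    have hpos' : (B.submatrix e e).toBlocks₁₁.PosDef := by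
      rw [toBlocks₁₁_eq_submatrix, submatrix_submatrix]
      exact hpos
    have hx' : B.submatrix e e *ᵥ (x ∘ e) = 0 := by
      rw [submatrix_mulVec_equiv B (x ∘ e) e e, Function.comp_assoc, e.self_comp_symm,
        Function.comp_id, hx]
      rfl
    obtain ⟨t, ht⟩ := exists_eq_mulVec_of_mulVec_eq_zero_blocks hBW' hpos' hx'
    refine ⟨t, ?_⟩
    have h1 : W.submatrix e id *ᵥ t = (W *ᵥ t) ∘ e := by
      rw [show (id : T → T) = ⇑(Equiv.refl T) from rfl, submatrix_mulVec_equiv]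
      rfl
    rw [h1] at ht
    funext i
    have := congrFun ht (e.symm i)
    simpa only [Function.comp_apply, Equiv.apply_symm_apply] using this
  · rintro ⟨t, rfl⟩
    rw [mulVec_mulVec, hBW, zero_mulVec]

/-- The kernel of `B` as a submodule is the range of `W`. [folklore] -/
theorem ker_mulVecLin_eq_range {S T m : Type*} [Fintype S] [Fintype T] [DecidableEq T] [Fintype m]
    {B : Matrix m m R} {W : Matrix m T R} (hBW : B * W = 0)
    (e : S ⊕ T ≃ m) [Invertible (W.submatrix e id).toRows₂]
    (hpos : (B.submatrix (e ∘ Sum.inl) (e ∘ Sum.inl)).PosDef) :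
    LinearMap.ker B.mulVecLin = LinearMap.range W.mulVecLin := by
  ext x
  rw [LinearMap.mem_ker, LinearMap.mem_range, mulVecLin_apply,
    mulVec_eq_zero_iff_of_posDef_kept hBW e hpos x]
  constructor
  · rintro ⟨t, rfl⟩
    exact ⟨t, rfl⟩
  · rintro ⟨t, rfl⟩
    exact ⟨t, rfl⟩

/-- **NULLITY = number of dropped indices** (`= rank W`, the structural kernel count). [folklore] -/
theorem finrank_ker_eq_card_dropped {S T m : Type*} [Fintype S] [Fintype T] [DecidableEq T] [Fintype m]
    {B : Matrix m m R} {W : Matrix m T R} (hBW : B * W = 0)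
    (e : S ⊕ T ≃ m) [Invertible (W.submatrix e id).toRows₂]
    (hpos : (B.submatrix (e ∘ Sum.inl) (e ∘ Sum.inl)).PosDef) :
    finrank R (LinearMap.ker B.mulVecLin) = Fintype.card T := by
  rw [ker_mulVecLin_eq_range hBW e hpos,
    LinearMap.finrank_range_of_inj (mulVecLin_injective_of_invertible_rows W e),
    finrank_fintype_fun_eq_card]

/-- **RANK = number of kept indices** (rank–nullity). [folklore] -/
theorem rank_eq_card_kept {S T m : Type*} [Fintype S] [Fintype T] [DecidableEq T] [Fintype m]
    {B : Matrix m m R} {W : Matrix m T R} (hBW : B * W = 0)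
    (e : S ⊕ T ≃ m) [Invertible (W.submatrix e id).toRows₂]
    (hpos : (B.submatrix (e ∘ Sum.inl) (e ∘ Sum.inl)).PosDef) :
    B.rank = Fintype.card S := by
  have h1 := LinearMap.finrank_range_add_finrank_ker B.mulVecLin
  rw [finrank_ker_eq_card_dropped hBW e hpos, finrank_fintype_fun_eq_card,
    ← Fintype.card_congr e, Fintype.card_sum] at h1
  change B.rank + Fintype.card T = Fintype.card S + Fintype.card T at h1
  omega

end Kernel

/-! ### §6 The screen with a δ-shift: PSD, exact kernel, nullity and rank from ONE integer certificate -/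

section Screen

variable {R : Type*} [Field R] [LinearOrder R] [IsStrictOrderedRing R] [StarRing R] [TrivialStar R]
variable {T m : Type*} [Fintype T] [DecidableEq T] [Fintype m] {k r : ℕ}

/-- **RESIDUAL SCREEN WITH SHIFT, ONE BLOCK.** `M` Hermitian, `M * W = 0` exactly, `e : Fin k ⊕ T ≃ m`
with the dropped rows of `W` invertible, and an integer certificate `IsGramCertZ A d F` for
`A = c • (M[S,S] − δ·1)` with `0 < c`, `0 < δ`. Then: `M ⪰ 0`; `M x = 0 ↔ x ∈ range W` (the structural
kernel is the whole kernel); `dim ker M = |T|`; `rank M = k`. [folklore] -/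
theorem kernel_exact_of_certZ_shift {M : Matrix m m R} (hM : M.IsHermitian) {W : Matrix m T R}
    (hMW : M * W = 0) (e : Fin k ⊕ T ≃ m) [Invertible (W.submatrix e id).toRows₂]
    {A : Matrix (Fin k) (Fin k) ℤ} {d : Fin r → ℕ} {F : Matrix (Fin r) (Fin k) ℤ}
    (hcert : PSD.IsGramCertZ A d F) {c δ : R} (hc : 0 < c) (hδ : 0 < δ)
    (hA : ∀ i j, ((A i j : ℤ) : R) =
      c * (M.submatrix (e ∘ Sum.inl) (e ∘ Sum.inl) - δ • (1 : Matrix (Fin k) (Fin k) R)) i j) :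
    M.PosSemidef ∧ (∀ x, M *ᵥ x = 0 ↔ ∃ t : T → R, x = W *ᵥ t) ∧
      finrank R (LinearMap.ker M.mulVecLin) = Fintype.card T ∧ M.rank = k := by
  have hsymm : (M.submatrix (e ∘ Sum.inl) (e ∘ Sum.inl)).IsSymm :=
    (isHermitian_iff_isSymm.mp hM).submatrix _
  have hpos : (M.submatrix (e ∘ Sum.inl) (e ∘ Sum.inl)).PosDef :=
    posDef_kept_of_certZ_shift hcert hc hδ hsymm hA
  refine ⟨?_, fun x => mulVec_eq_zero_iff_of_posDef_kept hMW e hpos x,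
    finrank_ker_eq_card_dropped hMW e hpos, ?_⟩
  · exact (posSemidef_iff_submatrix_of_mul_eq_zero hM hMW e).mpr hpos.posSemidef
  · rw [rank_eq_card_kept hMW e hpos, Fintype.card_fin]

end Screen

/-! ### §7 Usage template (checked): a `3 × 3` block with one structural kernel vector -/

section Example

/-- Template. Block `M = [[3,0,0],[0,2,2],[0,2,2]]` indexed by `Fin 2 ⊕ Fin 1` (kept `S = Fin 2`, dropped
`T = Fin 1`, `e = Equiv.refl`), structural kernel vector `W = (0, 1, -1)ᵀ` whose dropped row `[-1]` is
invertible, kept block `M[S,S] = diag(3, 2)`, shift `δ = 1`, scale `c = 1`, integer certificate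
`A = diag(2, 1) = Fᵀ·diag(2, 1)·F` with `F = 1` (residual `0`). Conclusion: `M ⪰ 0`, `rank M = 2` (one
structural kernel vector = the whole kernel), and the REAL matrix is PSD. -/
example :
    (fromBlocks !![3, 0; 0, 2] !![0; 2] !![0, 2] !![2] : Matrix (Fin 2 ⊕ Fin 1) (Fin 2 ⊕ Fin 1) ℚ).PosSemidef
    ∧ (fromBlocks !![3, 0; 0, 2] !![0; 2] !![0, 2] !![2] : Matrix (Fin 2 ⊕ Fin 1) (Fin 2 ⊕ Fin 1) ℚ).rank = 2
    ∧ ((fromBlocks !![3, 0; 0, 2] !![0; 2] !![0, 2] !![2] :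
        Matrix (Fin 2 ⊕ Fin 1) (Fin 2 ⊕ Fin 1) ℚ).map (Rat.cast : ℚ → ℝ)).PosSemidef := by
  set M : Matrix (Fin 2 ⊕ Fin 1) (Fin 2 ⊕ Fin 1) ℚ := fromBlocks !![3, 0; 0, 2] !![0; 2] !![0, 2] !![2]
    with hM_def
  set W : Matrix (Fin 2 ⊕ Fin 1) (Fin 1) ℚ := fromRows !![0; 1] !![-1] with hW_def
  have hM : M.IsHermitian := by
    rw [isHermitian_iff_isSymm, hM_def, Matrix.IsSymm, fromBlocks_transpose]
    congr 1 <;> ext i j <;> fin_cases i <;> fin_cases j <;> rfl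
  have hMW : M * W = 0 := by
    rw [hM_def, hW_def, fromBlocks_mul_fromRows, ← fromRows_zero]
    congr 1 <;> ext i j <;> fin_cases i <;> fin_cases j <;> simp
  haveI : Invertible (W.submatrix (⇑(Equiv.refl (Fin 2 ⊕ Fin 1))) id).toRows₂ := by
    refine ⟨!![-1], ?_, ?_⟩ <;> ext i j <;> fin_cases i <;> fin_cases j <;>
      simp [hW_def, Matrix.mul_apply, toRows₂]
  have hcert : PSD.IsGramCertZ !![2, 0; 0, 1] ![2, 1] !![1, 0; 0, 1] := by decide +kernel
  have hA : ∀ i j, (((!![2, 0; 0, 1] : Matrix (Fin 2) (Fin 2) ℤ) i j : ℤ) : ℚ) =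
      (1 : ℚ) * (M.submatrix (⇑(Equiv.refl (Fin 2 ⊕ Fin 1)) ∘ Sum.inl)
        (⇑(Equiv.refl (Fin 2 ⊕ Fin 1)) ∘ Sum.inl) - (1 : ℚ) • (1 : Matrix (Fin 2) (Fin 2) ℚ)) i j := by
    intro i j
    fin_cases i <;> fin_cases j <;> simp [hM_def] <;> norm_num
  obtain ⟨hpsd, -, -, hrank⟩ :=
    kernel_exact_of_certZ_shift hM hMW (Equiv.refl _) hcert one_pos one_pos hA
  exact ⟨hpsd, hrank, posSemidef_map_ratCast hpsd⟩

end Example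

end ResidualScreen

end Summit.Ventures.CertifiedQuantumChemistry
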